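import Summits.KontsevichZagierPeriods.Zeta5Search.TwoTaleOmega.StepEL

/-!
# (bmiss)@Ω — the recurrence in direction `aef`, FIRST TALE, generic in the certificate (cell `pub-zeta5`, cert-2 gen 5)

HONEST FRAMING: systematic search; recurrence certificates; no irrationality claim unless certified. Pure finite algebra
over `ℚ`; no named fact, no `sorry`.

Blueprint `families/tele/RECURRENCE.md` §14.11 (B), direction `δ = aef = (1,0,1,1,0)`, side `L`, on cert-1 g4's template (`StepEL`).
For `a ≥ 17` the aef RULE domain is 81 one-parameter families with 81 different telescopers `c_k(a)` and certificate polynomials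
`x_L(a,t)` (cert-2 g4 `TwoTaleTelescopeAef*`), but with ONE certificate shape: `Cert_L = t(t+a−e)(t+a−f)(t+g−1)·x_L(t)` (no denominator)
and Γ-ratios `F_L(p+kδ;t) = block(e,e+k)(t)·block(f,f+k)(t)·block(a,a+k)(t)·F_L(p;t)` (`vL_ratio_addAEF`; purely polynomial).  This file
proves the first-tale step ONCE for an ARBITRARY telescoper `c : Fin 4 → ℚ` and certificate polynomial `X : ℚ[X]` of degree `≤ 6`, under
the hypothesis `IdL c X p` = the cleared telescoping identity as a function identity in `t` (the shape of `telescope_aef<n>_L` with its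
atoms evaluated): `G = ofFrac [a,g) 1 (NfBL · X)` (`GfAEFL`), function identity off `SbL` by `telescope_assembly`, Lemma U, legitimacy at the
common node `node(p)` (double zero of the merged blocks, as for `e`), node moves of the four data from their own nodes (the median
`a₂*(e+k,f+k,b)` only grows along `δ`) through the double-zero window `sq_lin_dvd_num`.  OUTPUT `recL_aef` (truncation `d⁺ + 10`).
The 81 instantiations (family data ↦ `IdL`) are separate small files.
-/

noncomputable section

open Finset Polynomial
open Literature.NumberTheory.Irrationality.Zudilin2014
open Summit.KontsevichZagierPeriods.Zeta5Search.FormalBarnes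
open Summit.KontsevichZagierPeriods.Zeta5Search.Certificates.TwoTaleTelescope

namespace Summit.KontsevichZagierPeriods.Zeta5Search.TwoTaleOmega

namespace Pt

variable (p : Pt)

/-! ### Moving along `δ_aef` -/

/-- `p + k·(1,0,1,1,0)`. -/
def addAEF (k : ℤ) : Pt := ⟨p.a + k, p.b, p.e + k, p.f + k, p.g⟩

/-- Coordinates of `p.addAEF k`. -/
@[simp] theorem addAEF_a (k : ℤ) : (p.addAEF k).a = p.a + k := rfl
/-- Coordinates of `p.addAEF k`. -/
@[simp] theorem addAEF_b (k : ℤ) : (p.addAEF k).b = p.b := rfl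
/-- Coordinates of `p.addAEF k`. -/
@[simp] theorem addAEF_e (k : ℤ) : (p.addAEF k).e = p.e + k := rfl
/-- Coordinates of `p.addAEF k`. -/
@[simp] theorem addAEF_f (k : ℤ) : (p.addAEF k).f = p.f + k := rfl
/-- Coordinates of `p.addAEF k`. -/
@[simp] theorem addAEF_g (k : ℤ) : (p.addAEF k).g = p.g := rfl

/-- Along `δ_aef` the integer `d` grows by `3k`. -/
theorem dInt_addAEF (k : ℤ) : (p.addAEF k).dInt = p.dInt + 3 * k := by simp [dInt, addAEF]; ring

/-! ### The generic cleared identity (shape of `telescope_aef<n>_L`) -/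

/-- `F_L(p+kδ;t)/F_L(p;t) = block(e,e+k)·block(f,f+k)·block(a,a+k)` at `t`, written out for `k = 1,2,3`. -/
def ratL (k : ℕ) (t : ℚ) : ℚ :=
  if k = 1 then (t + p.e) * (t + p.f) * (t + p.a)
  else if k = 2 then (t + p.e) * (t + p.e + 1) * ((t + p.f) * (t + p.f + 1)) * ((t + p.a) * (t + p.a + 1))
  else (t + p.e) * (t + p.e + 1) * (t + p.e + 2) * ((t + p.f) * (t + p.f + 1) * (t + p.f + 2)) * ((t + p.a) * (t + p.a + 1) * (t + p.a + 2))

/-- The shift denominators `td = (t+1)(t+a−e+1)(t+a−f+1)(t+g)` and `tn = (t+e)(t+f)(t+b)(t+a)` (`vL_shift`). -/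
def tdL (t : ℚ) : ℚ := (t + 1) * (t + ((p.a : ℚ) - p.e + 1)) * (t + ((p.a : ℚ) - p.f + 1)) * (t + p.g)
/-- See `tdL`. -/
def tnL (t : ℚ) : ℚ := (t + p.e) * (t + p.f) * (t + p.b) * (t + p.a)
/-- The certificate factors `cnum = t(t+a−e)(t+a−f)(t+g−1)` and its shift `cnumS`. -/
def cnumL (t : ℚ) : ℚ := t * (t + ((p.a : ℚ) - p.e)) * (t + ((p.a : ℚ) - p.f)) * (t + ((p.g : ℚ) - 1))
/-- See `cnumL`. -/
def cnumSL (t : ℚ) : ℚ := (t + 1) * (t + ((p.a : ℚ) - p.e + 1)) * (t + ((p.a : ℚ) - p.f + 1)) * (t + p.g)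

/-- **The cleared first-tale telescoping identity of direction `aef`** for telescoper `c` and certificate polynomial `X` at the base
point `p`, as a function identity in `t` (`telescope_assembly`'s `hA` with `d_k = σ_k = cden = cdenS = 1`). -/
def IdL (c : Fin 4 → ℚ) (X : ℚ[X]) : Prop :=
  ∀ t : ℚ, (c 0 + c 1 * p.ratL 1 t + c 2 * p.ratL 2 t + c 3 * p.ratL 3 t) * p.tdL t
    = p.cnumSL t * X.eval (t + 1) * p.tnL t - p.cnumL t * X.eval t * p.tdL t

/-! ### Block algebra along `δ_aef` -/

/-- Along `δ_aef` the blocks `[1,e)` and `[a−e+1,f)` grow at the top: `num(p+kδ) = num(p)·block(e,e+k)·block(f,f+k)` (`k ≥ 0`, `p ∈ Ω`). -/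
theorem num_addAEF_eq (h : p.Omega) {k : ℤ} (hk : 0 ≤ k) :
    num (p.addAEF k).t1a (p.addAEF k).t1b = num p.t1a p.t1b * (block p.e (p.e + k) * block p.f (p.f + k)) := by
  have := h.b_ge; have := h.f_le; have := h.e_le; have := h.twoE; have := h.twoF; have := h.pos
  rw [num_t1, num_t1]
  simp only [addAEF_a, addAEF_b, addAEF_e, addAEF_f]
  rw [← block_mul_block (lo := 1) (mi := p.e) (hi := p.e + k) (by omega) (by omega),
    show p.a + k - (p.e + k) + 1 = p.a - p.e + 1 by ring,
    ← block_mul_block (lo := p.a - p.e + 1) (mi := p.f) (hi := p.f + k) (by omega) (by omega),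
    show p.a + k - (p.f + k) + 1 = p.a - p.f + 1 by ring]
  ring

/-- Along `δ_aef` the denominator loses bottom factors: `den(p) = block(a,a+k)·den(p+kδ)` (`0 ≤ k`, `a + k ≤ g`). -/
theorem den_addAEF_mul {k : ℤ} (hk : 0 ≤ k) (hkg : p.a + k ≤ p.g) :
    den p.t1a p.t1b = block p.a (p.a + k) * den (p.addAEF k).t1a (p.addAEF k).t1b := by
  rw [den_t1, den_t1]
  simp only [addAEF_a, addAEF_g]
  exact (block_mul_block (lo := p.a) (mi := p.a + k) (hi := p.g) (by omega) hkg).symm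

variable {p}

/-- **Γ-ratio along `δ_aef`, first tale**: `F_L(p+kδ;t) = block(e,e+k)(t)·block(f,f+k)(t)·block(a,a+k)(t)·F_L(p;t)` off the poles. -/
theorem vL_ratio_addAEF (h0 : p.Omega) {k : ℤ} (hk : (p.addAEF k).Omega) (hk0 : 0 ≤ k) {t : ℚ}
    (ht : ∀ j ∈ Ico p.a p.g, t + j ≠ 0) :
    (p.addAEF k).vL.eval t
      = (block p.e (p.e + k)).eval t * (block p.f (p.f + k)).eval t * (block p.a (p.a + k)).eval t * p.vL.eval t := by
  have hg := hk.a_lt_g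
  simp only [addAEF_a, addAEF_g] at hg
  have htk : ∀ j ∈ Ico (p.addAEF k).a (p.addAEF k).g, t + j ≠ 0 := fun j hj => by
    simp only [addAEF_a, addAEF_g, mem_Ico] at hj; exact ht j (by rw [mem_Ico]; omega)
  have hDk : (den (p.addAEF k).t1a (p.addAEF k).t1b).eval t ≠ 0 := den_eval_ne_zero _ htk
  have hBa : (block p.a (p.a + k)).eval t ≠ 0 := by
    rw [eval_block]; exact prod_ne_zero_iff.2 fun i hi => by rw [mem_Ico] at hi; exact ht i (by rw [mem_Ico]; omega)
  rw [vL_eval_w hk htk, vL_eval_w h0 ht, num_addAEF_eq p h0 hk0, den_addAEF_mul p hk0 (by omega)]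
  simp only [eval_mul]
  field_simp

/-- The Γ-ratio in the form `ratL`: `F_L(p+kδ;t) = ratL k t · F_L(p;t)` for `k = 1, 2, 3`. -/
theorem vL_ratL (h0 : p.Omega) (h1 : (p.addAEF 1).Omega) (h2 : (p.addAEF 2).Omega) (h3 : (p.addAEF 3).Omega)
    {t : ℚ} (ht : ∀ j ∈ Ico p.a p.g, t + j ≠ 0) :
    (p.addAEF 1).vL.eval t = p.ratL 1 t * p.vL.eval t ∧ (p.addAEF 2).vL.eval t = p.ratL 2 t * p.vL.eval t ∧
      (p.addAEF 3).vL.eval t = p.ratL 3 t * p.vL.eval t := by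
  have be := eval_block_123 p.e t
  have bf := eval_block_123 p.f t
  have ba := eval_block_123 p.a t
  refine ⟨?_, ?_, ?_⟩
  · rw [vL_ratio_addAEF h0 h1 (by norm_num) ht, be.1, bf.1, ba.1]; simp [ratL]
  · rw [vL_ratio_addAEF h0 h2 (by norm_num) ht, be.2.1, bf.2.1, ba.2.1]; simp [ratL]
  · rw [vL_ratio_addAEF h0 h3 (by norm_num) ht, be.2.2, bf.2.2, ba.2.2]; simp [ratL]

/-! ### The telescoped function `G = Cert_L · F_L(p;·)` as closed-form data -/

variable (p)

/-- Numerator of `G_{aef,L}`: the merged blocks `NfBL = t(t+a−e)(t+a−f)(t+g−1)·num` times the certificate polynomial `X`. -/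
def NfAEFL (X : ℚ[X]) : ℚ[X] := p.NfBL * X

/-- **The telescoped data** `G_{aef,L}(p) = ofFrac [a,g) 1 (NfBL·X)`. -/
def GfAEFL (X : ℚ[X]) : PF := PF.ofFrac (Ico p.a p.g) (fun _ => 1) (p.NfAEFL X)

/-- The poles of `G_{aef,L}` lie in `[a,g)`. -/
theorem poles_GfAEFL (X : ℚ[X]) : (p.GfAEFL X).poles ⊆ Ico p.a p.g := PF.poles_ofFrac _ _ _

/-- Value of `G_{aef,L}`: `cnum(t)·X(t)·num(t)/den(t)` off the poles. -/
theorem GfAEFL_eval (X : ℚ[X]) (h : p.Omega) {t : ℚ} (ht : ∀ k ∈ Ico p.a p.g, t + k ≠ 0) :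
    (p.GfAEFL X).eval t = p.cnumL t * X.eval t * ((num p.t1a p.t1b).eval t / (den p.t1a p.t1b).eval t) := by
  unfold GfAEFL NfAEFL
  rw [PF.eval_ofFrac _ _ _ (fun _ _ => Or.inl rfl) ht, denom_Ico_one, NfBL_eq p h, den_t1]
  simp only [eval_mul, eval_lin, cnumL]
  push_cast; ring

/-- Degree of the polynomial part of `G_{aef,L}`: `≤ d⁺ + 10` when `deg X ≤ 6`. -/
theorem natDegree_GfAEFL_le (X : ℚ[X]) (hX : X.natDegree ≤ 6) (h : p.Omega) :
    (p.GfAEFL X).poly.natDegree ≤ dExp p.t1a p.t1b + 10 := by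
  unfold GfAEFL NfAEFL
  have hN : (p.NfBL * X).natDegree ≤ (p.e).toNat + (p.f - (p.a - p.e)).toNat + (p.b - (p.a - p.f)).toNat + 1 + 6 :=
    natDegree_mul_le.trans (Nat.add_le_add (natDegree_NfBL p).le hX)
  rw [PF.natDegree_ofFrac, sum_const, Int.card_Ico, smul_eq_mul, mul_one]
  unfold dExp; rw [sum_t1a_sub_sum_t1b]; unfold dInt
  obtain ⟨h1, h2, h3, h4, h5, h6, h7, h8, h9⟩ := h
  omega

/-! ### Step (2): the function identity -/

variable {p}

/-- **Function identity** `Σ_k c_k F_L(p+kδ_aef;t) = G(t+1) − G(t)` off the exceptional set `SbL`, from the cleared identity `IdL`. -/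
theorem funId_aefL {c : Fin 4 → ℚ} {X : ℚ[X]} (hc : p.IdL c X)
    (h0 : p.Omega) (h1 : (p.addAEF 1).Omega) (h2 : (p.addAEF 2).Omega) (h3 : (p.addAEF 3).Omega) {t : ℚ}
    (ht : ∀ k ∈ p.SbL, t + k ≠ 0) :
    c 0 * p.vL.eval t + c 1 * (p.addAEF 1).vL.eval t + c 2 * (p.addAEF 2).vL.eval t
      + c 3 * (p.addAEF 3).vL.eval t = (p.GfAEFL X).eval (t + 1) - (p.GfAEFL X).eval t := by
  have o := h0
  obtain ⟨o1, o2, o3, o4, o5, o6, o7, o8, o9⟩ := h0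
  have hS : ∀ k ∈ Ico p.a p.g, t + k ≠ 0 := fun k hk => ht k (by
    unfold SbL; rw [mem_union]; left; rw [mem_Ico] at hk ⊢; omega)
  have hS1 : ∀ k ∈ Ico p.a p.g, t + 1 + k ≠ 0 := fun k hk => by
    have := ht (k + 1) (by unfold SbL; rw [mem_union]; left; rw [mem_Ico] at hk ⊢; omega)
    push_cast at this
    rwa [add_assoc, add_comm (1:ℚ)]
  have hg : t + p.g ≠ 0 := ht p.g (by unfold SbL; rw [mem_union]; left; rw [mem_Ico]; omega)
  have h1' : t + 1 ≠ 0 := by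
    have := ht 1 (by unfold SbL; rw [mem_union]; right; simp)
    push_cast at this; exact this
  have hae : t + (p.a - p.e + 1 : ℤ) ≠ 0 := ht _ (by unfold SbL; rw [mem_union]; right; simp)
  have haf : t + (p.a - p.f + 1 : ℤ) ≠ 0 := ht _ (by unfold SbL; rw [mem_union]; right; simp)
  push_cast at hae haf
  -- the four values and the shift
  set F0 := p.vL.eval t with hF0
  set F0' := p.vL.eval (t + 1) with hF0'
  have eN : (num p.t1a p.t1b).eval t / (den p.t1a p.t1b).eval t = F0 := (vL_eval_w o hS).symm
  obtain ⟨eF1, eF2, eF3⟩ := vL_ratL o h1 h2 h3 hS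
  have hshift := vL_shift o hS hS1
  rw [← hF0, ← hF0'] at hshift
  push_cast at hshift
  -- the values of G
  have eG0 : (p.GfAEFL X).eval t = p.cnumL t * X.eval t * F0 := by rw [GfAEFL_eval p X o hS, eN]
  have eG1 : (p.GfAEFL X).eval (t + 1) = p.cnumL (t + 1) * X.eval (t + 1) * F0' := by
    rw [GfAEFL_eval p X o hS1, hF0', vL_eval_w o hS1]
  have htd : p.tdL t ≠ 0 := by
    unfold tdL
    exact mul_ne_zero (mul_ne_zero (mul_ne_zero h1' hae) haf) hg
  have key := telescope_assembly (F0 := F0) (F0' := F0')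
    (F1 := (p.addAEF 1).vL.eval t) (F2 := (p.addAEF 2).vL.eval t) (F3 := (p.addAEF 3).vL.eval t)
    (c0 := c 0) (c1 := c 1) (c2 := c 2) (c3 := c 3) (s1 := 1) (s2 := 1) (s3 := 1)
    (n1 := p.ratL 1 t) (n2 := p.ratL 2 t) (n3 := p.ratL 3 t) (d1 := 1) (d2 := 1) (d3 := 1)
    (tn := p.tnL t) (td := p.tdL t) (cnum := p.cnumL t) (cnumS := p.cnumSL t) (cden := 1) (cdenS := 1)
    (x0 := X.eval t) (x1 := X.eval (t + 1))
    (by rw [eF1]; ring) (by rw [eF2]; ring) (by rw [eF3]; ring)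
    (by unfold tdL tnL; linear_combination hshift)
    one_ne_zero one_ne_zero one_ne_zero htd one_ne_zero one_ne_zero
    (by linear_combination hc t)
  rw [eG1, eG0, key]
  unfold cnumSL cnumL
  ring

/-! ### Step (3): the DATA identity -/

/-- **Data identity** `Σ_k c_k·vL(p+kδ_aef) = S G − G` (Lemma U over `SbL`). -/
theorem dataId_aefL {c : Fin 4 → ℚ} {X : ℚ[X]} (hc : p.IdL c X)
    (h0 : p.Omega) (h1 : (p.addAEF 1).Omega) (h2 : (p.addAEF 2).Omega) (h3 : (p.addAEF 3).Omega) :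
    PF.comb4 c ![p.vL, (p.addAEF 1).vL, (p.addAEF 2).vL, (p.addAEF 3).vL] = (p.GfAEFL X).shift.add ((p.GfAEFL X).smul (-1)) := by
  have hIco : Ico p.a p.g ⊆ p.SbL := fun k hk => by
    unfold SbL; rw [mem_union]; left; rw [mem_Ico] at hk ⊢; omega
  have hvk : ∀ q : Pt, q.Omega → p.a ≤ q.a → q.g = p.g → q.vL.poles ⊆ p.SbL := fun q hq hqa hqg => by
    refine (poles_vL q).trans (Subset.trans (Ico_subset_Ico ?_ ?_) hIco)
    · rw [amax_t1a_eq]; have := hq.e_le; have := hq.f_le; omega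
    · rw [hqg]
  refine PF.eq_of_eval_eq_on _ _ p.SbL ?_ ?_ fun t ht => ?_
  · refine (PF.poles_comb4_subset _ _).trans (union_subset (union_subset ?_ ?_) (union_subset ?_ ?_)) <;>
      simp only [Matrix.cons_val_zero, Matrix.cons_val_one, Matrix.cons_val_two, Matrix.cons_val_three,
        Matrix.head_cons, Matrix.tail_cons]
    · exact hvk p h0 le_rfl rfl
    · exact hvk _ h1 (by simp) rfl
    · exact hvk _ h2 (by simp) rfl
    · exact hvk _ h3 (by simp) rfl
  · refine (PF.poles_shift_sub_subset _).trans (union_subset ?_ ((poles_GfAEFL p X).trans hIco))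
    intro k hk
    obtain ⟨j, hj, rfl⟩ := mem_image.1 hk
    have hj' := poles_GfAEFL p X hj
    unfold SbL; rw [mem_union]; left; rw [mem_Ico] at hj' ⊢; omega
  · rw [PF.eval_comb4, PF.eval_shift_sub, Fin.sum_univ_four]
    simp only [Matrix.cons_val_zero, Matrix.cons_val_one, Matrix.cons_val_two, Matrix.cons_val_three,
      Matrix.head_cons, Matrix.tail_cons]
    exact funId_aefL hc h0 h1 h2 h3 ht

/-! ### Step (4): legitimacy at the common node `s* = node(p)` -/

/-- `ρ⁰_{s*}(G) = ρ¹_{s*}(G) = 0` at the node of `p` (double zero of the merged blocks; `X` only adds zeros). -/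
theorem GfAEFL_rho (X : ℚ[X]) (h : p.Omega) : rho0 p.nodeL (p.GfAEFL X) = 0 ∧ rho1 p.nodeL (p.GfAEFL X) = 0 := by
  have sp := a2star_t1a_eq h
  obtain ⟨o1, o2, o3, o4, o5, o6, o7, o8, o9⟩ := h
  set m := a2star p.t1a with hm
  have hnode : p.nodeL = -(m - 1) := by unfold nodeL; ring
  have hc : m - 1 ∉ Ico p.a p.g := by rw [mem_Ico]; omega
  rw [hnode]
  refine ⟨PF.rho0_ofFrac_eq_zero _ _ _ (fun _ _ => Or.inl rfl) hc ?_, PF.rho1_ofFrac_eq_zero _ _ _ hc⟩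
  have hcases : (0 ≤ m - 1 ∧ m - 1 < p.e ∧ p.a - p.e ≤ m - 1 ∧ m - 1 < p.f)
      ∨ (0 ≤ m - 1 ∧ m - 1 < p.e ∧ p.a - p.f ≤ m - 1 ∧ m - 1 < p.b)
      ∨ (p.a - p.e ≤ m - 1 ∧ m - 1 < p.f ∧ p.a - p.f ≤ m - 1 ∧ m - 1 < p.b) := by omega
  unfold NfAEFL NfBL
  refine Dvd.dvd.mul_right ?_ _
  rcases hcases with ⟨a1, a2, a3, a4⟩ | ⟨a1, a2, a3, a4⟩ | ⟨a1, a2, a3, a4⟩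
  · exact (pow_two (lin (m - 1)) ▸ mul_dvd_mul (lin_dvd_block a1 a2) (lin_dvd_block a3 a4)).mul_right _
      |>.mul_right _
  · refine (pow_two (lin (m - 1)) ▸ mul_dvd_mul (lin_dvd_block a1 a2) (lin_dvd_block a3 a4)).trans ?_
    exact ⟨block (p.a - p.e) p.f * lin (p.g - 1), by ring⟩
  · refine (pow_two (lin (m - 1)) ▸ mul_dvd_mul (lin_dvd_block a1 a2) (lin_dvd_block a3 a4)).trans ?_
    exact ⟨block 0 p.e * lin (p.g - 1), by ring⟩

/-! ### Step (5): node moves -/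

/-- Along `δ_aef` (`k ≥ 0`) the own node of `p+kδ` lies left of `s* = node(p)` (the median `a₂*(e+k,f+k,b)` only grows) and
`F_L(p+kδ;·)` has a double zero at every lattice point in between. -/
theorem lam_nodes_aefL (h0 : p.Omega) {k : ℤ} (hk0 : 0 ≤ k) (hk : (p.addAEF k).Omega) (D : ℕ)
    (hD : (p.addAEF k).vL.poly.natDegree ≤ D) :
    lam0 D (p.addAEF k).nodeL (p.addAEF k).vL = lam0 D p.nodeL (p.addAEF k).vL ∧
      lam1 (p.addAEF k).nodeL (p.addAEF k).vL = lam1 p.nodeL (p.addAEF k).vL := by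
  have sp := a2star_t1a_lin h0
  have spk := a2star_t1a_lin hk
  simp only [addAEF_b, addAEF_e, addAEF_f] at spk
  obtain ⟨o1, o2, o3, o4, o5, o6, o7, o8, o9⟩ := h0
  have hle : a2star p.t1a ≤ a2star (p.addAEF k).t1a := by omega
  obtain ⟨n, hn⟩ : ∃ n : ℕ, a2star (p.addAEF k).t1a = a2star p.t1a + n :=
    ⟨(a2star (p.addAEF k).t1a - a2star p.t1a).toNat, by rw [Int.toNat_of_nonneg (sub_nonneg.2 hle)]; ring⟩
  have hn0 : p.nodeL = 1 - a2star p.t1a := rfl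
  have hnk : (p.addAEF k).nodeL = 1 - a2star (p.addAEF k).t1a := rfl
  have hs : p.nodeL = (p.addAEF k).nodeL + n := by rw [hn0, hnk, hn]; ring
  rw [hs]
  have hek := hk.e_le; rw [addAEF_a, addAEF_e] at hek
  have ha : -(p.addAEF k).nodeL < (p.addAEF k).a := by rw [addAEF_a, hnk]; omega
  refine (lam_vL_move hk _ n D hD ha fun i hi => ?_).imp Eq.symm Eq.symm
  refine sq_lin_dvd_num hk ?_ ?_
  · rw [addAEF_a, addAEF_e, addAEF_f, hnk]; omega
  · rw [hnk]; omega

/-! ### Step (6): the first-tale recurrence of direction `aef` -/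

/-- **Direction `aef`, first tale, generic certificate.** For `p, p+δ, p+2δ, p+3δ ∈ Ω` (`δ = δ_aef`), a telescoper `c` and a
certificate polynomial `X` of degree `≤ 6` satisfying the cleared identity `IdL c X p`:
`Σ_k c_k·Λ¹_{node(p+kδ)}[vL(p+kδ)] = 0` and the same for `Λ⁰` with the common truncation `D = d⁺(p) + 10`. -/
theorem recL_aef {c : Fin 4 → ℚ} {X : ℚ[X]} (hX : X.natDegree ≤ 6) (hc : p.IdL c X)
    (h0 : p.Omega) (h1 : (p.addAEF 1).Omega) (h2 : (p.addAEF 2).Omega) (h3 : (p.addAEF 3).Omega) :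
    (c 0 * lam1 p.nodeL p.vL + c 1 * lam1 (p.addAEF 1).nodeL (p.addAEF 1).vL
      + c 2 * lam1 (p.addAEF 2).nodeL (p.addAEF 2).vL + c 3 * lam1 (p.addAEF 3).nodeL (p.addAEF 3).vL = 0) ∧
    (c 0 * lam0 (dExp p.t1a p.t1b + 10) p.nodeL p.vL
      + c 1 * lam0 (dExp p.t1a p.t1b + 10) (p.addAEF 1).nodeL (p.addAEF 1).vL
      + c 2 * lam0 (dExp p.t1a p.t1b + 10) (p.addAEF 2).nodeL (p.addAEF 2).vL
      + c 3 * lam0 (dExp p.t1a p.t1b + 10) (p.addAEF 3).nodeL (p.addAEF 3).vL = 0) := by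
  set D := dExp p.t1a p.t1b + 10 with hDdef
  have hdata := dataId_aefL hc h0 h1 h2 h3
  have hrho := GfAEFL_rho X h0
  have hDk : ∀ k : ℤ, 0 ≤ k → k ≤ 3 → (p.addAEF k).Omega → (p.addAEF k).vL.poly.natDegree ≤ D := fun k hk0 hk3 hq => by
    refine (vL_natDegree_le_w hq).trans ?_
    rw [hDdef]; unfold dExp; rw [sum_t1a_sub_sum_t1b, sum_t1a_sub_sum_t1b, dInt_addAEF]; omega
  have hD1 := hDk 1 (by norm_num) (by norm_num) h1
  have hD2 := hDk 2 (by norm_num) (by norm_num) h2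
  have hD3 := hDk 3 (by norm_num) (by norm_num) h3
  have m1 := lam_nodes_aefL h0 (by norm_num) h1 D hD1
  have m2 := lam_nodes_aefL h0 (by norm_num) h2 D hD2
  have m3 := lam_nodes_aefL h0 (by norm_num) h3 D hD3
  have s1 := lam1_step p.nodeL c _ (p.GfAEFL X) hdata
  have s0 := lam0_step D p.nodeL c _ (p.GfAEFL X) hdata (natDegree_GfAEFL_le p X hX h0)
  rw [Fin.sum_univ_four] at s1 s0
  simp only [Matrix.cons_val_zero, Matrix.cons_val_one, Matrix.cons_val_two, Matrix.cons_val_three,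
    Matrix.head_cons, Matrix.tail_cons] at s1 s0
  rw [hrho.2] at s1
  rw [hrho.1] at s0
  rw [m1.2, m2.2, m3.2, m1.1, m2.1, m3.1]
  exact ⟨s1, s0⟩

end Pt

end Summit.KontsevichZagierPeriods.Zeta5Search.TwoTaleOmega

end
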